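import Mathlib
import Literature.NumberTheory.LFunctions.Zhang2022.Section3Lemma31
import Literature.NumberTheory.LFunctions.Zhang2022.Section15U056Rate
import Literature.Analysis.Complex.CauchyTaylorBall
import HarnessLib

/-!
# `L(s,χ)` at `s = 1 − βⱼ` to second order, and the Taylor data of `M(z) = L(1+z−βⱼ,χ)²` at `z = 0`
# (the `L`-side input of the residue at `s = 0` in Zhang (2022) §15 p. 87, tex L4359–L4361)

Topic `Literature/NumberTheory/LFunctions/Zhang2022` (Landau–Siegel audit tree; verdict-neutral).
Y. Zhang, *Discrete mean estimates and the Landau–Siegel zero*, arXiv:2211.02515v1 (2022)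
[Zhang2022LandauSiegel] — **an unrefereed manuscript under adjudication**; nothing here asserts or denies
its Theorems 1–2. In the step "`Σ_{n<T} χ(n)τ₂(n)ϖ₁ⱼ(n)/n = L′(1,χ)²𝒰₁ⱼ(1) + O(α₁)`" (§15 p. 87) the
residue at the triple pole `s = 0` of `ζ(1+s)²L(1+s−βⱼ,χ)²U(1+s)Tˢω₁(s)/s` carries the factor
`M(z) = L(1+z−βⱼ,χ)²`; its Taylor data at `0` are controlled here from TREE THEOREMS only:
`‖L(w,χ)‖ ≤ 2e^{9/2}(1+𝓛)` for `‖w−1‖ ≤ 2/𝓛` and `‖L′(w,χ)‖ ≤ 2e^{9/2}(1+𝓛)𝓛` for `‖w−1‖ ≤ 1/𝓛`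
(`Lemma31.norm_LFunction_le_near_one`, `Lemma31.norm_deriv_LFunction_le_near_one`), Cauchy's estimates
and Taylor remainders on balls (`Literature.Analysis.Complex.CauchyTaylorBall`), `‖βⱼ‖ < 5α`
(`Ded1524.betaJ_norm_lt`) and Assumption (A) `‖L(1,χ)‖ < 𝓛⁻²⁰²²`:

* `norm_LFunction_taylor_two_le`, `norm_deriv_LFunction_sub_le`, `norm_iteratedDeriv_two_LFunction_le`
  — `L(1−β) = L(1) − βL′(1) + O(𝓛³|β|²)`, `L′(1−β) = L′(1) + O(𝓛³|β|)`, `L″(1−β) = O(𝓛³)` for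
  `‖β‖ ≤ 1/(4𝓛)`, `log D ≥ 3`, `χ` primitive;
* `sqShift_data` — `M(0) = L(1−β)²`, `M′(0) = 2L(1−β)L′(1−β)`, `M″(0) = 2L′(1−β)² + 2L(1−β)L″(1−β)`;
* `sqShift_bounds` — for all large `D`, under (A), `j ∈ {1,2,3}`: `‖M(0)‖ ≤ Cα²(1+‖L′(1,χ)‖)²`,
  `‖M′(0)‖ ≤ Cα(1+‖L′(1,χ)‖)²`, `‖½M″(0) − L′(1,χ)²‖ ≤ Cα𝓛³(1+‖L′(1,χ)‖)` with `C = 2000e^{9/2}`.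

Reading-independent (no error term of the display is asserted). WHAT THIS IS NOT: a proof of u055 in any
reading, nor anything about Theorems 1–2 / Landau–Siegel zeros.

## References
* Y. Zhang, arXiv:2211.02515v1 (2022), §15 p. 87, tex L4354–L4361; §5 Lemma 5.8 p. 24 (the shape
  `L(s,χ) = L′(1,χ)(s−1) + O(·)` near `1`). [cite: Zhang2022LandauSiegel, §15 p.87]
-/

noncomputable section

open Complex Real Set Filter Topology Metric

namespace Literature.NumberTheory.LFunctions.Zhang2022.U055

open Literature.NumberTheory.LFunctions.Zhang2022.Skeleton

/-! ### `L`, `L′`, `L″` at `1 − β` for `‖β‖ ≤ 1/(4 log q)` -/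

section LNearOne

variable {q : ℕ} [NeZero q] (χ : DirichletCharacter ℂ q)

/-- **Second-order Taylor remainder of `L(·,χ)` at `1`**: for `χ` primitive mod `q`, `log q ≥ 3` and
`‖β‖ ≤ 1/(4 log q)`, `‖L(1−β,χ) − L(1,χ) + β·L′(1,χ)‖ ≤ 16e^{9/2}(1 + log q)(log q)²‖β‖²`
(Cauchy–Taylor on the ball `|w−1| < 1/log q` with the tree's bound `‖L‖ ≤ 2e^{9/2}(1+log q)` there).
[cite: Zhang2022LandauSiegel, §5 Lemma 5.8 p.24] -/
theorem norm_LFunction_taylor_two_le (hq : 3 ≤ Real.log q) (hχ : χ.IsPrimitive) {β : ℂ}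
    (hβ : ‖β‖ ≤ 1 / (4 * Real.log q)) :
    ‖χ.LFunction (1 - β) - χ.LFunction 1 + β * deriv χ.LFunction 1‖ ≤
      16 * Real.exp (9 / 2) * (1 + Real.log q) * Real.log q ^ 2 * ‖β‖ ^ 2 := by
  have hq2 : 2 ≤ q := by
    rcases Nat.lt_or_ge q 2 with h | h
    · interval_cases q <;> norm_num at hq
    · exact h
  set Lq : ℝ := Real.log q with hL
  have hL0 : 0 < Lq := by linarith
  have hχ1 := Lemma31.ne_one_of_isPrimitive χ hq2 hχ
  have hR : 0 < 1 / Lq := one_div_pos.2 hL0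
  have hd : DifferentiableOn ℂ χ.LFunction (ball 1 (1 / Lq)) :=
    (DirichletCharacter.differentiable_LFunction hχ1).differentiableOn
  have hM : ∀ z ∈ ball (1 : ℂ) (1 / Lq), ‖χ.LFunction z‖ ≤ 2 * Real.exp (9 / 2) * (1 + Lq) := by
    intro z hz
    refine Lemma31.norm_LFunction_le_near_one χ hq hχ ?_
    rw [mem_ball, dist_eq_norm] at hz
    have : 1 / Lq ≤ 2 / Lq := div_le_div_of_nonneg_right (by norm_num) hL0.le
    exact hz.le.trans this
  have hz : ‖(1 - β) - 1‖ ≤ 1 / Lq / 4 := by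
    rw [show (1 : ℂ) - β - 1 = -β by ring, norm_neg]
    rw [div_div]; simpa [mul_comm] using hβ
  have h := Literature.Analysis.Complex.norm_sub_sub_le_of_forall_mem_ball hR hd hM hz
  rw [show (1 : ℂ) - β - 1 = -β by ring, norm_neg, smul_eq_mul] at h
  have e : χ.LFunction (1 - β) - χ.LFunction 1 - -β * deriv χ.LFunction 1 =
      χ.LFunction (1 - β) - χ.LFunction 1 + β * deriv χ.LFunction 1 := by ring
  rw [e] at h
  refine h.trans (le_of_eq ?_)
  field_simp
  ring

/-- **`L′(1−β,χ) − L′(1,χ) = O(𝓛³|β|)`**: for `χ` primitive, `log q ≥ 3`, `‖β‖ ≤ 1/(4 log q)`,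
`‖L′(1−β,χ) − L′(1,χ)‖ ≤ 8e^{9/2}(1+log q)(log q)²‖β‖` (Lipschitz bound for `L′` on `|w−1| < 1/(2log q)`
from the tree's `‖L′‖ ≤ 2e^{9/2}(1+log q)log q` on `|w−1| ≤ 1/log q`). [cite: Zhang2022LandauSiegel, §5 Lemma 5.8 p.24] -/
theorem norm_deriv_LFunction_sub_le (hq : 3 ≤ Real.log q) (hχ : χ.IsPrimitive) {β : ℂ}
    (hβ : ‖β‖ ≤ 1 / (4 * Real.log q)) :
    ‖deriv χ.LFunction (1 - β) - deriv χ.LFunction 1‖ ≤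
      8 * Real.exp (9 / 2) * (1 + Real.log q) * Real.log q ^ 2 * ‖β‖ := by
  have hq2 : 2 ≤ q := by
    rcases Nat.lt_or_ge q 2 with h | h
    · interval_cases q <;> norm_num at hq
    · exact h
  set Lq : ℝ := Real.log q with hL
  have hL0 : 0 < Lq := by linarith
  have hχ1 := Lemma31.ne_one_of_isPrimitive χ hq2 hχ
  have hR : 0 < 1 / Lq := one_div_pos.2 hL0
  have hdiff : Differentiable ℂ (deriv χ.LFunction) := by
    have h := DirichletCharacter.differentiable_LFunction hχ1
    exact (h.contDiff (n := 2)).differentiable_deriv_two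
  have hd : DifferentiableOn ℂ (deriv χ.LFunction) (ball 1 (1 / Lq)) := hdiff.differentiableOn
  have hM : ∀ z ∈ ball (1 : ℂ) (1 / Lq), ‖deriv χ.LFunction z‖ ≤
      2 * Real.exp (9 / 2) * (1 + Lq) * Lq := by
    intro z hz
    refine Lemma31.norm_deriv_LFunction_le_near_one χ hq hχ ?_
    rw [mem_ball, dist_eq_norm] at hz
    exact hz.le
  have hβ' : ‖β‖ < 1 / Lq / 2 := by
    have : 1 / (4 * Lq) < 1 / Lq / 2 := by
      rw [div_div, div_lt_div_iff_of_pos_left one_pos (by positivity) (by positivity)]; linarith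
    exact lt_of_le_of_lt hβ this
  have hz : (1 : ℂ) - β ∈ ball (1 : ℂ) (1 / Lq / 2) := by
    rw [mem_ball, dist_eq_norm, show (1 : ℂ) - β - 1 = -β by ring, norm_neg]; exact hβ'
  have hw : (1 : ℂ) ∈ ball (1 : ℂ) (1 / Lq / 2) := mem_ball_self (by positivity)
  have h := Literature.Analysis.Complex.norm_sub_le_mul_of_forall_mem_ball hR hd hM hz hw
  rw [show (1 : ℂ) - β - 1 = -β by ring, norm_neg] at h
  refine h.trans (le_of_eq ?_)
  field_simp
  ring

/-- **`L″(1−β,χ) = O(𝓛³)`**: for `χ` primitive, `log q ≥ 3`, `‖β‖ ≤ 1/(4 log q)`,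
`‖L″(1−β,χ)‖ ≤ 64e^{9/2}(1+log q)(log q)²` (Cauchy's estimate on the ball `|w−(1−β)| < 1/(2log q)`,
inside `|w−1| ≤ 2/log q` where `‖L‖ ≤ 2e^{9/2}(1+log q)`). [cite: Zhang2022LandauSiegel, §5 Lemma 5.8 p.24] -/
theorem norm_iteratedDeriv_two_LFunction_le (hq : 3 ≤ Real.log q) (hχ : χ.IsPrimitive) {β : ℂ}
    (hβ : ‖β‖ ≤ 1 / (4 * Real.log q)) :
    ‖iteratedDeriv 2 χ.LFunction (1 - β)‖ ≤ 64 * Real.exp (9 / 2) * (1 + Real.log q) * Real.log q ^ 2 := by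
  have hq2 : 2 ≤ q := by
    rcases Nat.lt_or_ge q 2 with h | h
    · interval_cases q <;> norm_num at hq
    · exact h
  set Lq : ℝ := Real.log q with hL
  have hL0 : 0 < Lq := by linarith
  have hχ1 := Lemma31.ne_one_of_isPrimitive χ hq2 hχ
  have hR : 0 < 1 / Lq / 2 := by positivity
  have hd : DifferentiableOn ℂ χ.LFunction (ball (1 - β) (1 / Lq / 2)) :=
    (DirichletCharacter.differentiable_LFunction hχ1).differentiableOn
  have hM : ∀ z ∈ ball (1 - β : ℂ) (1 / Lq / 2), ‖χ.LFunction z‖ ≤ 2 * Real.exp (9 / 2) * (1 + Lq) := by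
    intro z hz
    refine Lemma31.norm_LFunction_le_near_one χ hq hχ ?_
    rw [mem_ball, dist_eq_norm] at hz
    have h4 : 1 / (4 * Lq) ≤ 1 / Lq / 2 := by
      rw [div_div]; exact div_le_div_of_nonneg_left zero_le_one (by positivity) (by linarith)
    calc ‖z - 1‖ = ‖(z - (1 - β)) + (-β)‖ := by ring_nf
      _ ≤ ‖z - (1 - β)‖ + ‖-β‖ := norm_add_le _ _
      _ ≤ 1 / Lq / 2 + 1 / Lq / 2 := by rw [norm_neg]; exact add_le_add hz.le (hβ.trans h4)
      _ = 1 / Lq := by ring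
      _ ≤ 2 / Lq := div_le_div_of_nonneg_right (by norm_num) hL0.le
  have h := Literature.Analysis.Complex.norm_iteratedDeriv_two_le_of_forall_mem_ball hR hd hM
  refine h.trans (le_of_eq ?_)
  field_simp
  ring

end LNearOne


/-! ### Taylor data of `M(z) = L(1+z−β,χ)²` at `z = 0` -/

section SqShift

variable {q : ℕ} [NeZero q] (χ : DirichletCharacter ℂ q)

/-- Leibniz at order two (Mathlib `iteratedDeriv_mul`). [folklore] -/
private theorem iteratedDeriv_two_mul' {f g : ℂ → ℂ} {x : ℂ} (hf : ContDiffAt ℂ 2 f x)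
    (hg : ContDiffAt ℂ 2 g x) :
    iteratedDeriv 2 (fun z => f z * g z) x =
      iteratedDeriv 2 f x * g x + 2 * deriv f x * deriv g x + f x * iteratedDeriv 2 g x := by
  rw [iteratedDeriv_fun_mul hf hg]
  simp only [Finset.sum_range_succ, Finset.sum_range_zero, Nat.choose_zero_right,
    Nat.choose_one_right, Nat.choose_self, iteratedDeriv_zero, iteratedDeriv_one, Nat.cast_one,
    Nat.cast_ofNat, zero_add, Nat.sub_zero, Nat.reduceSub, show (2 : ℕ) - 2 = 0 from rfl]
  ring

/-- **Taylor data of `M(z) = L(1+z−β,χ)²` at `0`** (`χ ≠ 1`, so `L(·,χ)` is entire):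
`M(0) = L(1−β)²`, `M′(0) = 2L(1−β)L′(1−β)`, `M″(0) = 2L′(1−β)² + 2L(1−β)L″(1−β)`, and `M` is entire.
[cite: Zhang2022LandauSiegel, §15 p.87] -/
theorem sqShift_data (hχ1 : χ ≠ 1) (β : ℂ) :
    Differentiable ℂ (fun z : ℂ => χ.LFunction (1 + z - β) ^ 2) ∧
    (fun z : ℂ => χ.LFunction (1 + z - β) ^ 2) 0 = χ.LFunction (1 - β) ^ 2 ∧
    deriv (fun z : ℂ => χ.LFunction (1 + z - β) ^ 2) 0 =
      2 * χ.LFunction (1 - β) * deriv χ.LFunction (1 - β) ∧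
    iteratedDeriv 2 (fun z : ℂ => χ.LFunction (1 + z - β) ^ 2) 0 =
      2 * deriv χ.LFunction (1 - β) ^ 2 + 2 * χ.LFunction (1 - β) * iteratedDeriv 2 χ.LFunction (1 - β) := by
  have hL := DirichletCharacter.differentiable_LFunction hχ1
  set Lt : ℂ → ℂ := fun z => χ.LFunction ((1 - β) + z) with hLt
  have hLtd : Differentiable ℂ Lt := hL.comp ((differentiable_const _).add differentiable_id)
  have hM : (fun z : ℂ => χ.LFunction (1 + z - β) ^ 2) = fun z => Lt z * Lt z := by
    funext z; simp only [hLt]; rw [show (1 : ℂ) + z - β = 1 - β + z by ring]; ring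
  have hLt0 : Lt 0 = χ.LFunction (1 - β) := by simp [hLt]
  have hLt1 : deriv Lt 0 = deriv χ.LFunction (1 - β) := by
    simp only [hLt]; rw [deriv_comp_const_add]; simp
  have hLt2 : iteratedDeriv 2 Lt 0 = iteratedDeriv 2 χ.LFunction (1 - β) := by
    simp only [hLt]; rw [iteratedDeriv_comp_const_add]; simp
  have hc : ContDiffAt ℂ 2 Lt 0 := (hLtd.analyticAt 0).contDiffAt
  refine ⟨?_, ?_, ?_, ?_⟩
  · rw [hM]; exact hLtd.mul hLtd
  · simp
  · rw [hM, deriv_fun_mul (hLtd 0) (hLtd 0), hLt0, hLt1]; ring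
  · rw [hM, iteratedDeriv_two_mul' hc hc, hLt0, hLt1, hLt2]; ring

end SqShift

/-! ### The bounds for `β = βⱼ` under (A), for all large `D` -/

/-- `M ≤ 𝓛` once `D ≥ ⌈e^M⌉`. [cite: Zhang2022LandauSiegel, §2 (2.1)] -/
private theorem le_ell_of_ceil_exp_le₇ {M : ℝ} {D : ℕ} (hD : ⌈Real.exp M⌉₊ ≤ D) : M ≤ ell D := by
  have h : Real.exp M ≤ D := le_trans (Nat.le_ceil _) (by exact_mod_cast hD)
  exact (Real.le_log_iff_exp_le (lt_of_lt_of_le (Real.exp_pos _) h)).mpr h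

/-- Real bookkeeping for `sqShift_bounds`: from the pointwise data
`λ₀ ≤ ℓ₀ + bℓ + R₀b²`, `δ ≤ R₁b`, `λ₂ ≤ R₂` with `b ≤ 5α`, `ℓ₀ ≤ α`, `R₀·25α ≤ 1`, `R₁·5α ≤ 1`,
`R₁ ≤ 80A𝓛³`, `R₂ ≤ 128A𝓛³`, the three bounds with constant `2000A`. [folklore] -/
private theorem sqShift_bookkeeping {l0 l1 lam0 lam1 del lam2 b α L A R₀ R₁ R₂ : ℝ}
    (hA : 1 ≤ A) (hL : 1 ≤ L) (hα : 0 < α) (hl1 : 0 ≤ l1) (hlam0 : 0 ≤ lam0)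
    (hlam1 : 0 ≤ lam1) (hdel : 0 ≤ del) (hlam2 : 0 ≤ lam2) (hb : 0 ≤ b) (hb5 : b ≤ 5 * α)
    (hR₀ : 0 ≤ R₀)
    (h0 : lam0 ≤ l0 + b * l1 + R₀ * b ^ 2) (hδ : del ≤ R₁ * b) (h1 : lam1 ≤ l1 + del) (h2 : lam2 ≤ R₂)
    (hl0α : l0 ≤ α) (hR₀α : R₀ * (25 * α) ≤ 1) (hR₁α : R₁ * (5 * α) ≤ 1)
    (hR₁L : R₁ ≤ 80 * A * L ^ 3) (hR₂L : R₂ ≤ 128 * A * L ^ 3) :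
    lam0 ^ 2 ≤ 2000 * A * α ^ 2 * (1 + l1) ^ 2 ∧
      2 * lam0 * lam1 ≤ 2000 * A * α * (1 + l1) ^ 2 ∧
      del * (lam1 + l1) + lam0 * lam2 ≤ 2000 * A * α * L ^ 3 * (1 + l1) := by
  have hb2 : R₀ * b ^ 2 ≤ α := by
    calc R₀ * b ^ 2 ≤ R₀ * (5 * α) ^ 2 := by gcongr
      _ = R₀ * (25 * α) * α := by ring
      _ ≤ 1 * α := by gcongr
      _ = α := one_mul α
  have hlam0' : lam0 ≤ 6 * α * (1 + l1) := by nlinarith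
  have hdel' : del ≤ 1 := by nlinarith
  have hdel'' : del ≤ 80 * A * L ^ 3 * (5 * α) := by
    calc del ≤ R₁ * b := hδ
      _ ≤ (80 * A * L ^ 3) * (5 * α) := by gcongr
  have hlam1' : lam1 ≤ l1 + 1 := by linarith
  have hL3 : 1 ≤ L ^ 3 := one_le_pow₀ hL
  refine ⟨?_, ?_, ?_⟩
  · calc lam0 ^ 2 ≤ (6 * α * (1 + l1)) ^ 2 := pow_le_pow_left₀ hlam0 hlam0' 2
      _ = 36 * α ^ 2 * (1 + l1) ^ 2 := by ring
      _ ≤ 2000 * A * α ^ 2 * (1 + l1) ^ 2 := by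
        have : 0 ≤ α ^ 2 * (1 + l1) ^ 2 := by positivity
        nlinarith
  · calc 2 * lam0 * lam1 ≤ 2 * (6 * α * (1 + l1)) * (l1 + 1) := by gcongr
      _ = 12 * α * (1 + l1) ^ 2 := by ring
      _ ≤ 2000 * A * α * (1 + l1) ^ 2 := by
        have : 0 ≤ α * (1 + l1) ^ 2 := by positivity
        nlinarith
  · have hx : del * (lam1 + l1) ≤ (80 * A * L ^ 3 * (5 * α)) * (l1 + 1 + l1) :=
      mul_le_mul hdel'' (by linarith) (by positivity) (by positivity)
    have hy : lam0 * lam2 ≤ (6 * α * (1 + l1)) * (128 * A * L ^ 3) :=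
      mul_le_mul hlam0' (h2.trans hR₂L) hlam2 (by positivity)
    have e : (80 * A * L ^ 3 * (5 * α)) * (l1 + 1 + l1) + (6 * α * (1 + l1)) * (128 * A * L ^ 3) =
        A * α * L ^ 3 * (1568 * l1 + 1168) := by ring
    have : 0 ≤ A * α * L ^ 3 := by positivity
    nlinarith

/-- **The `L`-data of the residue at `s = 0`, under (A), for all large `D`**: with `βⱼ` of (2.13)
(`j ∈ {1,2,3}`; `‖βⱼ‖ < 5α`), `M(z) = L(1+z−βⱼ,χ)²` and `ℓ = ‖L′(1,χ)‖`:
`‖M(0)‖ ≤ Cα²(1+ℓ)²`, `‖M′(0)‖ ≤ Cα(1+ℓ)²`, `‖½M″(0) − L′(1,χ)²‖ ≤ Cα𝓛³(1+ℓ)`, `C = 2000e^{9/2}`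
(from `L(1−βⱼ) = L(1,χ) − βⱼL′(1,χ) + O(𝓛³α²)`, `|L(1,χ)| < 𝓛⁻²⁰²² ≤ α` by (A),
`L′(1−βⱼ) = L′(1) + O(𝓛³α)`, `L″(1−βⱼ) = O(𝓛³)`). [cite: Zhang2022LandauSiegel, §15 p.87] -/
theorem sqShift_bounds (c' : ℝ) :
    ForAllLarge fun D _ χ => AssumptionA D χ → ∀ j ∈ ({1, 2, 3} : Finset ℕ),
      ‖χ.LFunction (1 - betaJ c' D j) ^ 2‖ ≤
          2000 * Real.exp (9 / 2) * alpha D ^ 2 * (1 + ‖deriv χ.LFunction 1‖) ^ 2 ∧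
        ‖deriv (fun z : ℂ => χ.LFunction (1 + z - betaJ c' D j) ^ 2) 0‖ ≤
          2000 * Real.exp (9 / 2) * alpha D * (1 + ‖deriv χ.LFunction 1‖) ^ 2 ∧
        ‖iteratedDeriv 2 (fun z : ℂ => χ.LFunction (1 + z - betaJ c' D j) ^ 2) 0 / 2 -
            deriv χ.LFunction 1 ^ 2‖ ≤
          2000 * Real.exp (9 / 2) * alpha D * ell D ^ 3 * (1 + ‖deriv χ.LFunction 1‖) := by
  set M : ℝ := max 8 (14 * |c'| * π + 1) with hMdef
  refine ForAllLarge.of_le ⌈Real.exp M⌉₊ fun D _ χ hD hq hp hA j hj => ?_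
  have hMℓ : M ≤ ell D := le_ell_of_ceil_exp_le₇ hD
  have hℓ8 : 8 ≤ ell D := (le_max_left _ _).trans hMℓ
  have hℓc : 14 * |c'| * π + 1 ≤ ell D := (le_max_right _ _).trans hMℓ
  have hℓ3 : 3 ≤ ell D := by linarith
  have hℓ1 : 1 ≤ ell D := by linarith
  have hℓ0 : 0 < ell D := by linarith
  have hD2 : 2 ≤ D := by
    by_contra hlt
    have : D ≤ 1 := by omega
    have : (D : ℝ) ≤ 1 := by exact_mod_cast this
    have : ell D ≤ 0 := by
      rw [ell]; exact Real.log_nonpos (Nat.cast_nonneg _) this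
    linarith
  have hχ1 := Lemma31.ne_one_of_isPrimitive χ hD2 hp
  -- `α`
  have hα : alpha D = π / ell D ^ 9 := by rw [alpha, bigP, Real.log_exp]
  have hαpos : 0 < alpha D := by rw [hα]; positivity
  have hθ : |c' * alpha D * ell D| ≤ 1 / 14 := by
    have hα1 : alpha D * ell D = π / ell D ^ 8 := by rw [hα]; field_simp
    rw [abs_mul, abs_mul, abs_of_pos hαpos, abs_of_pos hℓ0, mul_assoc, hα1,
      show |c'| * (π / ell D ^ 8) = |c'| * π / ell D ^ 8 by ring,
      div_le_div_iff₀ (by positivity) (by norm_num)]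
    have h8 : ell D ≤ ell D ^ 8 := by
      calc ell D = ell D ^ 1 := (pow_one _).symm
        _ ≤ ell D ^ 8 := pow_le_pow_right₀ hℓ1 (by norm_num)
    nlinarith [abs_nonneg c', Real.pi_pos]
  obtain ⟨hβ5, -⟩ := Ded1524.betaJ_norm_lt c' hαpos hθ hj
  set β := betaJ c' D j with hβdef
  -- `5α ≤ 1/(4𝓛)` (as `20π ≤ 𝓛⁸`)
  have h5α : 5 * alpha D ≤ 1 / (4 * ell D) := by
    rw [hα, show 5 * (π / ell D ^ 9) = 5 * π / ell D ^ 9 by ring,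
      div_le_div_iff₀ (by positivity) (by positivity)]
    have h8 : (64 : ℝ) ≤ ell D ^ 8 := by
      calc (64 : ℝ) = 2 ^ 6 := by norm_num
        _ ≤ ell D ^ 6 := pow_le_pow_left₀ (by norm_num) (by linarith) 6
        _ ≤ ell D ^ 8 := pow_le_pow_right₀ hℓ1 (by norm_num)
    have : 5 * π * (4 * ell D) = 20 * π * ell D := by ring
    rw [this]
    calc 20 * π * ell D ≤ 64 * ell D := by nlinarith [Real.pi_lt_d2]
      _ ≤ ell D ^ 8 * ell D := by gcongr
      _ = 1 * ell D ^ 9 := by ring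
  have hβ4 : ‖β‖ ≤ 1 / (4 * ell D) := hβ5.le.trans h5α
  have hℓD : (3 : ℝ) ≤ Real.log D := hℓ3
  -- the three pointwise lemmas at `q = D`
  have hT := norm_LFunction_taylor_two_le χ hℓD hp hβ4
  have hS := norm_deriv_LFunction_sub_le χ hℓD hp hβ4
  have hI := norm_iteratedDeriv_two_LFunction_le χ hℓD hp hβ4
  obtain ⟨-, hM0, hM1, hM2⟩ := sqShift_data χ hχ1 β
  -- abbreviations
  set A : ℝ := Real.exp (9 / 2) with hAdef
  have hA1 : 1 ≤ A := Real.one_le_exp (by norm_num)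
  set ℓ := ‖deriv χ.LFunction 1‖ with hℓ'
  set l0 := ‖χ.LFunction 1‖
  set lam0 := ‖χ.LFunction (1 - β)‖
  set lam1 := ‖deriv χ.LFunction (1 - β)‖
  set lam2 := ‖iteratedDeriv 2 χ.LFunction (1 - β)‖
  set del := ‖deriv χ.LFunction (1 - β) - deriv χ.LFunction 1‖
  change (3 : ℝ) ≤ ell D at hℓD
  -- `λ₀ ≤ ℓ₀ + |β|ℓ + 16A(1+𝓛)𝓛²|β|²`
  have h0 : lam0 ≤ l0 + ‖β‖ * ℓ + 16 * A * (1 + ell D) * ell D ^ 2 * ‖β‖ ^ 2 := by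
    have e : χ.LFunction (1 - β) = (χ.LFunction (1 - β) - χ.LFunction 1 + β * deriv χ.LFunction 1) +
        χ.LFunction 1 - β * deriv χ.LFunction 1 := by ring
    calc lam0 = ‖(χ.LFunction (1 - β) - χ.LFunction 1 + β * deriv χ.LFunction 1) +
          χ.LFunction 1 - β * deriv χ.LFunction 1‖ := by simp only [lam0]; rw [← e]
      _ ≤ ‖χ.LFunction (1 - β) - χ.LFunction 1 + β * deriv χ.LFunction 1‖ + ‖χ.LFunction 1‖ +
            ‖β * deriv χ.LFunction 1‖ := by
          refine (norm_sub_le _ _).trans ?_; gcongr; exact norm_add_le _ _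
      _ ≤ 16 * A * (1 + ell D) * ell D ^ 2 * ‖β‖ ^ 2 + l0 + ‖β‖ * ℓ := by
          rw [norm_mul]; gcongr; exact hT
      _ = _ := by ring
  -- `λ₁ ≤ ℓ + δ`
  have h1 : lam1 ≤ ℓ + del := by
    calc lam1 = ‖deriv χ.LFunction 1 + (deriv χ.LFunction (1 - β) - deriv χ.LFunction 1)‖ := by
          simp only [lam1]; congr 1; ring
      _ ≤ ℓ + del := norm_add_le _ _
  -- (A): `ℓ₀ ≤ 𝓛⁻²⁰²² ≤ α`
  have hl0α : l0 ≤ alpha D := by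
    have hA' : l0 < 1 / Real.log D ^ 2022 := hA
    change l0 < 1 / ell D ^ 2022 at hA'
    refine hA'.le.trans ?_
    rw [hα, div_le_div_iff₀ (by positivity) (by positivity), one_mul]
    calc ell D ^ 9 = ell D ^ 9 * 1 := (mul_one _).symm
      _ ≤ ell D ^ 2022 * π :=
          mul_le_mul (pow_le_pow_right₀ hℓ1 (by norm_num)) (by linarith [Real.pi_gt_three])
            zero_le_one (by positivity)
      _ = π * ell D ^ 2022 := mul_comm _ _
  -- absorption: `800·e^{9/2}·π ≤ 𝓛⁶`
  have hA91 : A ≤ 91 := by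
    have h9 : A ^ 2 = Real.exp 1 ^ 9 := by
      rw [hAdef, ← Real.exp_nat_mul, ← Real.exp_nat_mul]; norm_num
    have h2 : Real.exp 1 ^ 9 ≤ (2.7182818286 : ℝ) ^ 9 :=
      pow_le_pow_left₀ (Real.exp_pos 1).le Real.exp_one_lt_d9.le 9
    have h3 : (2.7182818286 : ℝ) ^ 9 < 91 ^ 2 := by norm_num
    have hA0 : 0 ≤ A := by rw [hAdef]; exact (Real.exp_pos _).le
    nlinarith
  have hℓ6 : 800 * A * π ≤ ell D ^ 6 := by
    calc 800 * A * π ≤ 800 * 91 * 3.15 := by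
          have := Real.pi_lt_d2
          have hA0 : 0 ≤ A := by rw [hAdef]; exact (Real.exp_pos _).le
          nlinarith [Real.pi_pos]
      _ ≤ (8 : ℝ) ^ 6 := by norm_num
      _ ≤ ell D ^ 6 := pow_le_pow_left₀ (by norm_num) hℓ8 6
  have h1ℓ : 1 + ell D ≤ 2 * ell D := by linarith
  -- the `R`-constants
  have hR₀α : 16 * A * (1 + ell D) * ell D ^ 2 * (25 * alpha D) ≤ 1 := by
    rw [hα]
    have e : 16 * A * (1 + ell D) * ell D ^ 2 * (25 * (π / ell D ^ 9)) =
        (400 * A * π * ((1 + ell D) * ell D ^ 2)) / ell D ^ 9 := by ring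
    rw [e, div_le_one (by positivity)]
    calc 400 * A * π * ((1 + ell D) * ell D ^ 2) ≤ 400 * A * π * (2 * ell D * ell D ^ 2) := by
          gcongr
      _ = (800 * A * π) * ell D ^ 3 := by ring
      _ ≤ ell D ^ 6 * ell D ^ 3 := by gcongr
      _ = ell D ^ 9 := by ring
  have hR₁α : 8 * A * (1 + ell D) * ell D ^ 2 * (5 * alpha D) ≤ 1 := by
    have : 8 * A * (1 + ell D) * ell D ^ 2 * (5 * alpha D) ≤
        16 * A * (1 + ell D) * ell D ^ 2 * (25 * alpha D) := by
      have h0 : 0 ≤ A * (1 + ell D) * ell D ^ 2 * alpha D := by positivity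
      nlinarith
    exact this.trans hR₀α
  have hR₁L : 8 * A * (1 + ell D) * ell D ^ 2 ≤ 80 * A * ell D ^ 3 := by
    calc 8 * A * (1 + ell D) * ell D ^ 2 ≤ 8 * A * (2 * ell D) * ell D ^ 2 := by gcongr
      _ = 16 * A * ell D ^ 3 := by ring
      _ ≤ 80 * A * ell D ^ 3 := by gcongr; norm_num
  have hR₂L : 64 * A * (1 + ell D) * ell D ^ 2 ≤ 128 * A * ell D ^ 3 := by
    calc 64 * A * (1 + ell D) * ell D ^ 2 ≤ 64 * A * (2 * ell D) * ell D ^ 2 := by gcongr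
      _ = 128 * A * ell D ^ 3 := by ring
  -- bookkeeping
  have hδ : del ≤ 8 * A * (1 + ell D) * ell D ^ 2 * ‖β‖ := hS
  obtain ⟨b0, b1, b2⟩ := sqShift_bookkeeping (l0 := l0) (l1 := ℓ) (lam0 := lam0) (lam1 := lam1)
    (del := del) (lam2 := lam2) (b := ‖β‖) (α := alpha D) (L := ell D) (A := A)
    (R₀ := 16 * A * (1 + ell D) * ell D ^ 2) (R₁ := 8 * A * (1 + ell D) * ell D ^ 2)
    (R₂ := 64 * A * (1 + ell D) * ell D ^ 2) hA1 hℓ1 hαpos (norm_nonneg _)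
    (norm_nonneg _) (norm_nonneg _) (norm_nonneg _) (norm_nonneg _) (norm_nonneg _) hβ5.le
    (by positivity) (by linarith [h0]) hδ h1 hI hl0α hR₀α hR₁α hR₁L hR₂L
  refine ⟨?_, ?_, ?_⟩
  · rw [norm_pow]; exact b0
  · rw [hM1, norm_mul, norm_mul, Complex.norm_two]; exact b1
  · rw [hM2]
    have e : (2 * deriv χ.LFunction (1 - β) ^ 2 +
        2 * χ.LFunction (1 - β) * iteratedDeriv 2 χ.LFunction (1 - β)) / 2 - deriv χ.LFunction 1 ^ 2 =
        (deriv χ.LFunction (1 - β) - deriv χ.LFunction 1) * (deriv χ.LFunction (1 - β) + deriv χ.LFunction 1) +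
          χ.LFunction (1 - β) * iteratedDeriv 2 χ.LFunction (1 - β) := by ring
    rw [e]
    calc _ ≤ ‖(deriv χ.LFunction (1 - β) - deriv χ.LFunction 1) *
            (deriv χ.LFunction (1 - β) + deriv χ.LFunction 1)‖ +
          ‖χ.LFunction (1 - β) * iteratedDeriv 2 χ.LFunction (1 - β)‖ := norm_add_le _ _
      _ ≤ del * (lam1 + ℓ) + lam0 * lam2 := by
          rw [norm_mul, norm_mul]
          gcongr
          exact norm_add_le _ _
      _ ≤ _ := b2

end Literature.NumberTheory.LFunctions.Zhang2022.U055
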